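import Summits.AtomisticToContinuum.Crystallization.Theorems.ChartedZeroExcessLayeredLatticeLiouvilleZZZYRCZT

/-!
# Charted zero-excess layered-lattice Liouville — ZZZYRCZX: the CELL-ID LEAVES of the class re-indexing — H-BAND and HOLLOW STACKING (gate (h1))

Cell `decomp-a2c`, lens 2 («special vs generic»), generation 100.  Line (D) TAIL-DEBIT of `UniformEquilStabilityAt`, R3-W door (ZZZYRCZT).
Under the line of record (h1) = CLEAN BAND (r1872 (D2)), the door asks for the re-indexing INTO THE BANDED CLASS
`UniformReindexPC s Λ c₀ ℓ₀ (IsRegisteredWordB δ hLoB hHiB)`.  This file factors that obligation into the registered re-indexing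
`UniformReindexPC … (IsRegisteredWord δ)` (ZZZYRCZN: (RI♯) + the registry lemma) and two PURE CELL-ID statements over `IsAdmissibleWord`,
both ATTACKABLE-L from `IsClean`'s two-shell pattern (some close-packed plane of the matched 18-point fcc/hcp pattern is the chart plane up to
tilt `O(1/16)`; the three cross-layer neighbours sit in HOLLOW sites at pattern height `√(2/3)·a_q ± a_q/16`, `a_q/a ∈ [(1−s)·8/9, (1+s)·8/7]`):
§1 ★ **«HBandP s Λ c₀ ℓ₀ hLoB hHiB»** — along every unit normal of the chart plane every interlayer spacing lies in `[hLoB·a, hHiB·a]`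
   (census band `[0.7397, 0.89]`); `uniformReindexPC_banded` PROVES registered ∧ band ⇒ banded (the normal component of a registered step IS
   its height), `uniformEquilStabilityAt_of_atlasW_band` is the door with `hRI` split accordingly.
§2 ★ **«HollowP s Λ c₀ ℓ₀ δ»** — the in-plane part of every step exceeds the slip dial `δ·a` (no atom-on-atom stacking); with it the
   re-indexing lands in the banded HOLLOW class `IsRegisteredWordBH` (consecutive letters distinct, `IsHollowSeq`), the hollow shape cells
   `InBoxWH` cover it (`atlasCoversPC_of_shapeCoverWH`), and `uniformEquilStabilityAt_of_atlasW_hollow` is the door of record for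
   letter-function boxes whose near tables range over the `3·2^{2H₀}` HOLLOW window types only (ZZZYRCZY §1) instead of all `3^{2H₀+1}`.
So the typed ATTACKABLE-L obligations of the cover under (h1) are literally `HBandP` and `HollowP` (plus (ABAND) `ScaleBandP`, ZZZYRCZT).

Theorem file (5 defs, 11 theorems); imports ZZZYRCZT only; no instance / notation / option; 0 sorry. [g100]
-/

namespace Summit.AtomisticToContinuum.Crystallization.Theorems.ChartedZeroExcessLayeredLatticeLiouville

open scoped BigOperators RealInnerProductSpace
open Summit.AtomisticToContinuum.Crystallization.Theorems.ChartedPlanarOrderRigidityDoor (E3)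
open Summit.AtomisticToContinuum.Crystallization.Theorems.ChartedPlanarOrderMesoCut (LayeredHom)
open Summit.AtomisticToContinuum.Crystallization.Theorems.ChartedPlanarOrderDoorLayered (Layered)

variable {ι : Type*}

/-! ### §1 the H-band -/

/-- ★ **«HBandP s Λ c₀ ℓ₀ hLoB hHiB»** — THE H-BAND (CELL-ID, ATTACKABLE-L from `IsClean`): along every unit normal of the chart plane, every
interlayer spacing of an admissible word at scale `a` lies in `[hLoB·a, hHiB·a]` in absolute value.  Why it might fail: only by a band narrower
than the two-shell tolerance allows (census [0.7397, 0.89] is the computed clean band). [g100] -/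
def HBandP (s Λ c₀ ℓ₀ hLoB hHiB : ℝ) : Prop :=
  ∀ a : ℝ, 0 < a → ∀ (L : E3 ≃L[ℝ] E3) (w' : ℤ → E3), IsAdmissibleWord a s Λ c₀ ℓ₀ L w' →
    ∀ n : E3, ‖n‖ = 1 → ⟪gen₁ L, n⟫ = 0 → ⟪gen₂ L, n⟫ = 0 →
      ∀ m : ℤ, hLoB * a ≤ |⟪w' (m + 1) - w' m, n⟫| ∧ |⟪w' (m + 1) - w' m, n⟫| ≤ hHiB * a

/-- a wider band holds a fortiori. [g100] -/
theorem hBandP_mono {s Λ c₀ ℓ₀ hLoB hHiB hLoB' hHiB' : ℝ} (hlo : hLoB' ≤ hLoB) (hhi : hHiB ≤ hHiB') (h : HBandP s Λ c₀ ℓ₀ hLoB hHiB) :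
    HBandP s Λ c₀ ℓ₀ hLoB' hHiB' := fun a ha L w' hA n hn hg₁ hg₂ m =>
  ⟨(mul_le_mul_of_nonneg_right hlo ha.le).trans (h a ha L w' hA n hn hg₁ hg₂ m).1,
    (h a ha L w' hA n hn hg₁ hg₂ m).2.trans (mul_le_mul_of_nonneg_right hhi ha.le)⟩

/-- the normal component of a registered step `c•(g₁ + g₂) + r + h•n` is its height `h`. [g100] -/
theorem inner_registeredStep {g₁ g₂ r n : E3} (hn : ‖n‖ = 1) (hg₁ : ⟪g₁, n⟫ = 0) (hg₂ : ⟪g₂, n⟫ = 0) (hr : ⟪r, n⟫ = 0) (c h : ℝ) :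
    ⟪c • (g₁ + g₂) + r + h • n, n⟫ = h := by
  rw [inner_add_left, inner_add_left, real_inner_smul_left, inner_add_left, hg₁, hg₂, hr, real_inner_smul_left,
    real_inner_self_eq_norm_sq, hn]
  ring

/-- ★★ **THE FACTORISATION (PROVED)**: registered re-indexing ∧ H-band ⇒ re-indexing into the banded registered class. [g100] -/
theorem uniformReindexPC_banded {s Λ c₀ ℓ₀ δ hLoB hHiB : ℝ} (hRI : UniformReindexPC s Λ c₀ ℓ₀ (IsRegisteredWord δ))
    (hB : HBandP s Λ c₀ ℓ₀ hLoB hHiB) : UniformReindexPC s Λ c₀ ℓ₀ (IsRegisteredWordB δ hLoB hHiB) := by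
  intro a ha L w hE
  obtain ⟨w', hset, hco, hlip, hreg⟩ := hRI a ha L w hE
  refine ⟨w', hset, hco, hlip, ?_⟩
  have hadm : IsAdmissibleWord a s Λ c₀ ℓ₀ L w' := isAdmissibleWord_of_equilChart hE hset hco hlip
  obtain ⟨ℓ, n, r, h, hℓ, hn, hg₁, hg₂, hr, hstep⟩ := hreg
  have hband := hB a ha L w' hadm n hn hg₁ hg₂
  refine ⟨ℓ, n, r, h, hℓ, hn, hg₁, hg₂, fun m => ⟨(hr m).1, (hr m).2.1, ?_⟩, fun m => ?_⟩
  · have hm : ⟪w' (m + 1) - w' m, n⟫ = h m := by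
      rw [hstep m]
      exact inner_registeredStep hn hg₁ hg₂ (hr m).2.1 _ _
    have habs : |⟪w' (m + 1) - w' m, n⟫| = h m := by rw [hm, abs_of_pos (hr m).2.2]
    have hb := hband m
    rw [habs] at hb
    exact hb
  · rw [hstep m]

/-- ★ THE R3-W DOOR WITH THE RE-INDEXING SPLIT: ZZZYRCZT's `uniformEquilStabilityAt_of_atlasW` with `hRI` := registered re-indexing + H-band. [g100] -/
theorem uniformEquilStabilityAt_of_atlasW_band {s Λ c₀ ℓ₀ r₁ ϱ R cZ κ₁ κ₀ γT δ hLoB hHiB amin amax : ℝ} {aLo aHi τ hLo hHi c cK : ι → ℝ}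
    {ΘR ΘN : ι → (E3 ≃L[ℝ] E3) → (ℤ → E3) → (Cell 2 × ℤ) × (Cell 2 × ℤ) → ℝ}
    (h0 : 0 ≤ κ₁) (hκ : κ₀ ≤ κ₁ * cZ - γT) (hRI : UniformReindexPC s Λ c₀ ℓ₀ (IsRegisteredWord δ)) (hHB : HBandP s Λ c₀ ℓ₀ hLoB hHiB)
    (hcK0 : ∀ i, 0 ≤ cK i) (hcK : ∀ i, cK i * c i ≤ 1)
    (hCS : CellSumP s Λ c₀ ℓ₀ r₁) (hNC : CellNullLagrangianP s Λ c₀ ℓ₀ r₁) (hband : ScaleBandP s Λ c₀ ℓ₀ amin amax)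
    (hcover : ∀ a : ℝ, amin ≤ a → a ≤ amax → ∃ i, aLo i ≤ a ∧ a ≤ aHi i ∧ δ ≤ τ i ∧ hLo i ≤ hLoB ∧ hHiB ≤ hHi i)
    (hcell : ∀ i, BoxCellCertificateP s Λ c₀ ℓ₀ r₁ (InBoxW s (aLo i) (aHi i) (τ i) (hLo i) (hHi i)) (c i))
    (htail : ∀ i, BoxTailDebitP s Λ c₀ ℓ₀ ϱ (InBoxW s (aLo i) (aHi i) (τ i) (hLo i) (hHi i)) (ΘR i) (ΘN i) γT)
    (hPU : PartitionIdentityFullP s Λ c₀ ℓ₀ r₁ ϱ R) (hPD : PartitionIdentityDebitP s Λ c₀ ℓ₀ ϱ R)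
    (hclus : ∀ i, BoxClusterCertificateDebitP s Λ c₀ ℓ₀ r₁ ϱ R (InBoxW s (aLo i) (aHi i) (τ i) (hLo i) (hHi i)) (cK i) (ΘR i) (ΘN i) κ₁)
    (hCZ : IndexCurrencyP s Λ c₀ ℓ₀ r₁ cZ) : UniformEquilStabilityAt s Λ κ₀ c₀ :=
  uniformEquilStabilityAt_of_atlasW h0 hκ (uniformReindexPC_banded hRI hHB) hcK0 hcK hCS hNC hband hcover hcell htail hPU hPD hclus hCZ

/-- conversely, a banded re-indexing exhibits, for every equilibrium chart, SOME unit normal along which the band holds (the band is a property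
of the layering, recorded here as the cheap converse for the refuter's census). [g100] -/
theorem exists_normal_band_of_banded {s Λ c₀ ℓ₀ δ hLoB hHiB a : ℝ} {L : E3 ≃L[ℝ] E3} {w : ℤ → E3}
    (hRI : UniformReindexPC s Λ c₀ ℓ₀ (IsRegisteredWordB δ hLoB hHiB)) (ha : 0 < a) (hE : IsEquilChart a s Λ L w) (hlo : 0 < hLoB) :
    ∃ (w' : ℤ → E3) (n : E3), Layered (gen₁ L) (gen₂ L) w' = LayeredHom (L : E3 →L[ℝ] E3) w ∧ ‖n‖ = 1 ∧
      ∀ m : ℤ, hLoB * a ≤ |⟪w' (m + 1) - w' m, n⟫| ∧ |⟪w' (m + 1) - w' m, n⟫| ≤ hHiB * a := by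
  obtain ⟨w', hset, _, _, ℓ, n, r, h, _, hn, hg₁, hg₂, hr, hstep⟩ := hRI a ha L w hE
  refine ⟨w', n, hset, hn, fun m => ?_⟩
  have hm : ⟪w' (m + 1) - w' m, n⟫ = h m := by
    rw [hstep m]
    exact inner_registeredStep hn hg₁ hg₂ (hr m).2.1 _ _
  have hpos : 0 < h m := (mul_pos hlo ha).trans_le (hr m).2.2.1
  rw [hm, abs_of_pos hpos]
  exact (hr m).2.2

/-! ### §2 hollow stacking -/

/-- consecutive letters distinct (every layer sits in the hollow sites of the previous one). [g100] -/
def IsHollowSeq (ℓ : ℤ → ℤ) : Prop := ∀ m : ℤ, ℓ (m + 1) ≠ ℓ m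

/-- ★ **«HollowP s Λ c₀ ℓ₀ δ»** — HOLLOW STACKING (CELL-ID, ATTACKABLE-L from `IsClean`): along every unit normal of the chart plane, the
in-plane part of every step of an admissible word at scale `a` is longer than the slip dial `δ·a`.  Why it might fail: only for a slip dial
`δ` above the hollow offset `≈ a/√3` minus tolerances. [g100] -/
def HollowP (s Λ c₀ ℓ₀ δ : ℝ) : Prop :=
  ∀ a : ℝ, 0 < a → ∀ (L : E3 ≃L[ℝ] E3) (w' : ℤ → E3), IsAdmissibleWord a s Λ c₀ ℓ₀ L w' →
    ∀ n : E3, ‖n‖ = 1 → ⟪gen₁ L, n⟫ = 0 → ⟪gen₂ L, n⟫ = 0 →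
      ∀ m : ℤ, δ * a < ‖(w' (m + 1) - w' m) - ⟪w' (m + 1) - w' m, n⟫ • n‖

/-- **«IsRegisteredWordBH δ hLoB hHiB a L w'»** — the banded registered class with HOLLOW stacking (consecutive letters distinct). [g100] -/
def IsRegisteredWordBH (δ hLoB hHiB a : ℝ) (L : E3 ≃L[ℝ] E3) (w' : ℤ → E3) : Prop :=
  ∃ (ℓ : ℤ → ℤ) (n : E3) (r : ℤ → E3) (h : ℤ → ℝ), IsLetterSeq ℓ ∧ IsHollowSeq ℓ ∧ ‖n‖ = 1 ∧ ⟪gen₁ L, n⟫ = 0 ∧ ⟪gen₂ L, n⟫ = 0 ∧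
    (∀ m, ‖r m‖ ≤ δ * a ∧ ⟪r m, n⟫ = 0 ∧ hLoB * a ≤ h m ∧ h m ≤ hHiB * a) ∧
    ∀ m : ℤ, w' (m + 1) - w' m = (((ℓ (m + 1) : ℝ) - ℓ m) / 3) • (gen₁ L + gen₂ L) + r m + h m • n

/-- forgetting hollowness. [g100] -/
theorem isRegisteredWordB_of_hollow {δ hLoB hHiB a : ℝ} {L : E3 ≃L[ℝ] E3} {w' : ℤ → E3} (h : IsRegisteredWordBH δ hLoB hHiB a L w') :
    IsRegisteredWordB δ hLoB hHiB a L w' := by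
  obtain ⟨ℓ, n, r, hh, hℓ, _, hn, hg₁, hg₂, hrh, hstep⟩ := h
  exact ⟨ℓ, n, r, hh, hℓ, hn, hg₁, hg₂, hrh, hstep⟩

/-- ★★ **THE SECOND FACTORISATION (PROVED)**: registered re-indexing ∧ H-band ∧ hollow stacking ⇒ re-indexing into the banded hollow class
(a repeated letter would make the in-plane part of the step the slip `r m`, of norm `≤ δ·a`). [g100] -/
theorem uniformReindexPC_bandedHollow {s Λ c₀ ℓ₀ δ hLoB hHiB : ℝ} (hRI : UniformReindexPC s Λ c₀ ℓ₀ (IsRegisteredWord δ))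
    (hB : HBandP s Λ c₀ ℓ₀ hLoB hHiB) (hH : HollowP s Λ c₀ ℓ₀ δ) : UniformReindexPC s Λ c₀ ℓ₀ (IsRegisteredWordBH δ hLoB hHiB) := by
  intro a ha L w hE
  obtain ⟨w', hset, hco, hlip, hreg⟩ := uniformReindexPC_banded hRI hB a ha L w hE
  refine ⟨w', hset, hco, hlip, ?_⟩
  have hadm : IsAdmissibleWord a s Λ c₀ ℓ₀ L w' := isAdmissibleWord_of_equilChart hE hset hco hlip
  obtain ⟨ℓ, n, r, h, hℓ, hn, hg₁, hg₂, hr, hstep⟩ := hreg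
  refine ⟨ℓ, n, r, h, hℓ, fun m heq => ?_, hn, hg₁, hg₂, hr, hstep⟩
  have hm : ⟪w' (m + 1) - w' m, n⟫ = h m := by
    rw [hstep m]
    exact inner_registeredStep hn hg₁ hg₂ (hr m).2.1 _ _
  have hlt := hH a ha L w' hadm n hn hg₁ hg₂ m
  rw [hm, hstep m, add_sub_cancel_right, heq, sub_self, zero_div, zero_smul, zero_add] at hlt
  exact (not_lt.mpr (hr m).1) hlt

/-- ★ IN A HOLLOW SHAPE CELL: some hollow letter sequence puts `(L, w')` in the slab box. [g100] -/
def InBoxWH (s aLo aHi τ hLo hHi : ℝ) (L : E3 ≃L[ℝ] E3) (w' : ℤ → E3) : Prop :=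
  ∃ ℓ : ℤ → ℤ, IsLetterSeq ℓ ∧ IsHollowSeq ℓ ∧ SlabBoxF ℓ aLo aHi s τ hLo hHi L w'

/-- a hollow shape cell lies in the shape cell (so ZZZYRCZT/ZZZYRCZO/ZZZYRCZP apply to it). [g100] -/
theorem inBoxW_of_inBoxWH {s aLo aHi τ hLo hHi : ℝ} {L : E3 ≃L[ℝ] E3} {w' : ℤ → E3} (h : InBoxWH s aLo aHi τ hLo hHi L w') :
    InBoxW s aLo aHi τ hLo hHi L w' := by
  obtain ⟨ℓ, hℓ, _, hB⟩ := h
  exact ⟨ℓ, hℓ, hB⟩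

/-- a banded hollow registered admissible word lies in every hollow shape cell whose dials contain its scale, slip bound and band. [g100] -/
theorem inBoxWH_of_registeredBH {s Λ c₀ ℓ₀ δ hLoB hHiB a aLo aHi τ hLo hHi : ℝ} {L : E3 ≃L[ℝ] E3} {w' : ℤ → E3} (ha : 0 ≤ a)
    (hA : IsAdmissibleWord a s Λ c₀ ℓ₀ L w') (hreg : IsRegisteredWordBH δ hLoB hHiB a L w') (haLo : aLo ≤ a) (haHi : a ≤ aHi) (hτ : δ ≤ τ)
    (hlo : hLo ≤ hLoB) (hhi : hHiB ≤ hHi) : InBoxWH s aLo aHi τ hLo hHi L w' := by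
  obtain ⟨ℓ, n, r, hh, hℓ, hH, hn, hg₁, hg₂, hrh, hstep⟩ := hreg
  exact ⟨ℓ, hℓ, hH, a, n, r, hh, haLo, haHi, hA.2.2.1, hn, hg₁, hg₂, fun m => (hrh m).1.trans (mul_le_mul_of_nonneg_right hτ ha),
    fun m => ⟨(mul_le_mul_of_nonneg_right hlo ha).trans (hrh m).2.2.1, (hrh m).2.2.2.trans (mul_le_mul_of_nonneg_right hhi ha)⟩,
    fun m => (hrh m).2.1, hstep⟩

/-- JSBOX-SOUND for hollow cells: a scale cover by H-band cells covers the banded hollow class by hollow shape cells. [g100] -/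
theorem atlasCoversPC_of_shapeCoverWH {s Λ c₀ ℓ₀ δ hLoB hHiB amin amax : ℝ} {aLo aHi τ hLo hHi : ι → ℝ}
    (hband : ScaleBandP s Λ c₀ ℓ₀ amin amax)
    (hcover : ∀ a : ℝ, amin ≤ a → a ≤ amax → ∃ i, aLo i ≤ a ∧ a ≤ aHi i ∧ δ ≤ τ i ∧ hLo i ≤ hLoB ∧ hHiB ≤ hHi i) :
    AtlasCoversPC s Λ c₀ ℓ₀ (IsRegisteredWordBH δ hLoB hHiB) fun i => InBoxWH s (aLo i) (aHi i) (τ i) (hLo i) (hHi i) := by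
  intro a ha L w' hA hreg
  obtain ⟨h₁, h₂⟩ := hband a ha L w' hA
  obtain ⟨i, haLo, haHi, hτ, hlo, hhi⟩ := hcover a h₁ h₂
  exact ⟨i, inBoxWH_of_registeredBH ha.le hA hreg haLo haHi hτ hlo hhi⟩

/-- ★★ **THE R3-W DOOR OF RECORD FOR LETTER-FUNCTION BOXES**: ZZZYRCZN's class door at the banded hollow class and hollow shape cells, with the
re-indexing split into registered re-indexing + `HBandP` + `HollowP` and coverage discharged by the scale cover. [g100] -/
theorem uniformEquilStabilityAt_of_atlasW_hollow {s Λ c₀ ℓ₀ r₁ ϱ R cZ κ₁ κ₀ γT δ hLoB hHiB amin amax : ℝ} {aLo aHi τ hLo hHi c cK : ι → ℝ}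
    {ΘR ΘN : ι → (E3 ≃L[ℝ] E3) → (ℤ → E3) → (Cell 2 × ℤ) × (Cell 2 × ℤ) → ℝ}
    (h0 : 0 ≤ κ₁) (hκ : κ₀ ≤ κ₁ * cZ - γT) (hRI : UniformReindexPC s Λ c₀ ℓ₀ (IsRegisteredWord δ)) (hHB : HBandP s Λ c₀ ℓ₀ hLoB hHiB)
    (hHol : HollowP s Λ c₀ ℓ₀ δ) (hcK0 : ∀ i, 0 ≤ cK i) (hcK : ∀ i, cK i * c i ≤ 1)
    (hCS : CellSumP s Λ c₀ ℓ₀ r₁) (hNC : CellNullLagrangianP s Λ c₀ ℓ₀ r₁) (hband : ScaleBandP s Λ c₀ ℓ₀ amin amax)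
    (hcover : ∀ a : ℝ, amin ≤ a → a ≤ amax → ∃ i, aLo i ≤ a ∧ a ≤ aHi i ∧ δ ≤ τ i ∧ hLo i ≤ hLoB ∧ hHiB ≤ hHi i)
    (hcell : ∀ i, BoxCellCertificateP s Λ c₀ ℓ₀ r₁ (InBoxWH s (aLo i) (aHi i) (τ i) (hLo i) (hHi i)) (c i))
    (htail : ∀ i, BoxTailDebitP s Λ c₀ ℓ₀ ϱ (InBoxWH s (aLo i) (aHi i) (τ i) (hLo i) (hHi i)) (ΘR i) (ΘN i) γT)
    (hPU : PartitionIdentityFullP s Λ c₀ ℓ₀ r₁ ϱ R) (hPD : PartitionIdentityDebitP s Λ c₀ ℓ₀ ϱ R)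
    (hclus : ∀ i, BoxClusterCertificateDebitP s Λ c₀ ℓ₀ r₁ ϱ R (InBoxWH s (aLo i) (aHi i) (τ i) (hLo i) (hHi i)) (cK i) (ΘR i) (ΘN i) κ₁)
    (hCZ : IndexCurrencyP s Λ c₀ ℓ₀ r₁ cZ) : UniformEquilStabilityAt s Λ κ₀ c₀ :=
  uniformEquilStabilityAt_of_atlasC h0 hκ (uniformReindexPC_bandedHollow hRI hHB hHol) hcK0 hcK hCS hNC
    (atlasCoversPC_of_shapeCoverWH hband hcover) hcell htail hPU hPD hclus hCZ

end Summit.AtomisticToContinuum.Crystallization.Theorems.ChartedZeroExcessLayeredLatticeLiouville
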